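import Literature.MathematicalPhysics.QuantumFieldTheory.Balaban1983to89.B3Ineq211ZeroTorus
import Literature.MathematicalPhysics.QuantumFieldTheory.Balaban1983to89.B3Sect3KernelsZeroTorus
import Literature.MathematicalPhysics.QuantumFieldTheory.Balaban1983to89.B3GkZeroBoxSeparated

/-!
# `Balaban1983to89.B3GkZeroTorusSeparated` — T. Bałaban, *(Higgs)₂,₃ quantum fields in a finite volume. III. Renormalization*,
# Commun. Math. Phys. **88** (1983) 411–445 [Balaban1983Higgs3], (3.1) p. 432: the KERNEL ESTIMATES behind
# `‖hG_k(Ω,B̃)h′‖_{1,α} ≤ O(1)e^{−δ₀dist(□(v),□(v′))}`, PROVED for the TORUS MODEL INSTANCE `A = B̃ = 0`, `Ω = T_η` (the paper's own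
# lattice): the zero-field torus propagator `G_k(T_η,0;x,x′) = G^ε_k`, its lattice derivatives in either variable, the Hölder
# quotients of these derivatives and the mixed second differences are ALL `≤ C·(scale factor of k)·e^{−δ₀|x−x′|_T/L^k}` at
# SEPARATED arguments `|x−x′|_T ≥ ρL^k` (`ρ > 0`), uniformly in the volume `(m, K)` and the scale `1 ≤ k ≤ K`

statement-level skeleton of published theorems with citation tags; proofs where landed; nothing here is a claim about the Yang–Mills mass gap

PDF held: `paper:balaban1983-higgs-2-3-quantum-fields-finite-volume` (journal page = PDF page + 410); p. 420 [PDF 10] (1.32), p. 424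
[PDF 14] (2.6), p. 426 [PDF 16] (2.10)–(2.11) and p. 432 [PDF 22] (3.1) read in the OCR text (`p0010.txt`, `p0014.txt`, `p0016.txt`,
`p0022.txt`) and on the render `run/shared/lean/pub/pub-balaban/b2b-balaban-ref1/pages/1983-cmp88-higgs23-III/…-p016-x2.png`.

CITATION HEADER (lean-in-tree rule).  Part of the lit-balaban TYPED SKELETON (HOME `run/shared/lean/pub/lit-balaban/`), Phase 2:
SKELETON row **B3.Eq3.1** (`HOME/lit-balaban-r15/ROWS-B3.md`, fold owner r15; decl of record `B3Sect3Statements.Sect3Data.Ineq31`,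
typed p239220 over the ABSTRACT carrier `Sect3Data`); file 1 of 2 of the member «TORUS MODEL INSTANCE A = B̃ = 0, Ω = T_η» (file 2,
`B3Ineq31ZeroTorus`, assembles the two-variable norm (1.32) of `1_{□(v)}G_k1_{□(v′)}` from the estimates below).  TORUS TWIN of
this seat's `B3GkZeroBoxSeparated` (p256156, Neumann boxes `Ω = □`); a thin assembly over the kernel-proved torus files of rows
B3.Eq2.6/2.10/2.11 used BY NAME: `B3Ineq210ZeroTorus` (p258063: the pieces `pieceT`, (2.6) `sum_pieceT`, (2.10) `ineq210_zeroTorus`),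
`B3Ineq211ZeroTorus` (p259170: (2.11) `ineq211At_zeroTorusH`), p20 g5's `B3Ineq210MixedTorus` (p260636: the twice-differentiated
clause `ineq210_mixed_zeroTorus`) and `B3Sect3KernelsZeroTorus` (`pieceT_symm`), and the real-variable scale sum of the box twin
(`B3GkZeroBoxSeparated.scaleSum_sep_le`); nothing of these is re-proved.

WHAT IS PRINTED (B3 p. 432 [PDF 22]): *"Now if two vertices, v, v′ have localizations satisfying dist(□(v), □(v′)) ≥ 1, then we
consider every propagator corresponding to a line connecting these vertices as an external field also. Such a possibility is
assured by the following estimates ‖hG_k(Ω,B̃)h′‖_{1,α} ≤ O(1)e^{−δ₀dist(□(v),□(v′))}, (3.1) and similarly for the vector field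
propagator, h, h′ are localization functions."*; (1.32) p. 420: *"‖f‖_{1,α} = sup_x |f(x)| + sup_{x,μ} |(D^η_{B,μ}f)(x)| +
sup_{x,x′,μ} |x − x′|^{−α}|U(B(Γ_{x,x′}))(D^η_{B,μ}f)(x′) − (D^η_{B,μ}f)(x)|, (1.32) … This definition extends in a natural way to
functions of many variables."*; (2.6)/(2.10) p. 424/426: `G_k(Ω,B̃) = Σ_{j=0}^{k−1}G^η_{(j)}(Ω,B̃)`, *"|G^η_{(j)}(Ω, B̃; x, x′)| ≤
O(1)(L^jη)^{−d+2}e^{−δ₁(L^jη)^{−1}|x−x′|}, (2.10) and if the propagator is differentiated, then for each differentiation, there is an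
additional factor (L^jη)^{−1} on the right side. This applies also to Hölder norms"* (2.11).

WHAT IS REPRODUCED (kind «model-instance», G.1 of `HOME/PHASE2-TARGETS.md`).  On Bałaban's CONCRETE scalar torus tower
`B1RG242Torus.tower P a msq` (volume `P = (d, L, m, K)`, finest torus `T^{(0)} = Site P 0`, `ε = L^{−K}`, `U ≡ 1`, `G^ε_k = G_k(T_η,0)`),
in the `ε^d`-normalisation of the companions (`G^ε = ε^{−d}G`, distances `|x−x′|_T` = sup torus distance in fine units), for the
FULL propagator `G^ε_k = Σ_{j<k}G_{(j)}` at SEPARATION `|x−x′|_T ≥ ρL^k`, any `ρ > 0`, every `1 ≤ k ≤ K`: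
* §0 the scale bookkeeping (`L^jε·L^{k−j} = L^kε`; below the separation scale the weights `(L^jε)^{a}((L^jε)^d)^{−1}` of the pieces are
  at most `(L^{k−j})^d` times the weight of the top scale) and the generic summation `abs_sum_range_sep_le` over the pieces
  (the scale sum `B3GkZeroBoxSeparated.scaleSum_sep_le`: `Σ_{j<k}s_j^pe^{−δDs_j} ≤ C(p,δ,ρ,L)e^{−(δL/2)D}`, `s_j = L^{k−j}`, `D ≥ ρ`);
* §1 the symmetry of `G^ε_k` (`Gk_symm`, from `pieceT_symm` and (2.6)) and the entry formulas of the differences;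
* §2 the SIX kernel clauses, each `∃ δ₀ C > 0 ∀ volume (d, L fixed) ∀ 1 ≤ k ≤ K ∀ points at separation ρL^k`:
  **`abs_Gk_sep_le`** (value: `ε^{−d}|G_k(x,x′)| ≤ C(L^kε)²((L^kε)^d)^{−1}e^{−δ₀|x−x′|_T/L^k}`), **`abs_GkDiff_sep_le`** /
  **`abs_GkDiff'_sep_le`** (row / column forward difference quotient: one power of `L^kε` fewer), **`abs_GkDD_sep_le`** /
  **`abs_GkDD'_sep_le`** (Hölder quotient of the row derivative in the row variable / of the column derivative in the column
  variable, per `0 ≤ α < 1`, weight `((L^kε)^α)^{−1}` more, decay in `dist({x₁,x₂},x) = min(|x₁−x|_T,|x₂−x|_T)`),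
  **`abs_GkMixed_sep_le`** (mixed second difference: weight `((L^kε)^d)^{−1}`);
* §3 a non-vacuity witness.

HONEST SCOPE / DECLARED DIVERGENCES (F7).  (i) As the companions: `A = B̃ = 0` (`U ≡ 1`, one component), `Ω = T_η` the WHOLE torus
(not subsets, not `δG_k(Ω,Ω₂,B̃)`), torus sides `2L^{m+K}`, odd `L`; FIXED `a > 0`, `m² ≥ 0` (not a window).  (ii) Derivatives =
forward differences along the unit vectors of `T^{(0)}` (`Site.shift`), in the stated variable, divided by `ε`.  (iii) Sup torus
distance `B5Ineq137Torus.T` (the print does not fix the norm).  (iv) Constants existential, depending on `d, L, a, m², ρ` (and `α`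
for the Hölder clauses, as printed for the cited Proposition I.2.1: «c₀ on α also»), uniform in the volume `(m, K)`, the scale
`k ≤ K` and the points; exponents not optimised (every scale weight is bounded through `(L^{k−j})^d` before summing).  (v) The scale
factors of `k` (`(L^kε)^{2}`, `(L^kε)^{1}`, `(L^kε)^{1−α}` against `((L^kε)^d)^{−1}`) are kept explicit: in the print's units for the
step `k` (`η = L^{−k}`, unit lattice = `k`-blocks) they are exactly absorbed by the rescaling — that conversion is file 2's.
(vi) This file does NOT yet speak about `‖·‖_{1,α}` or localization functions (file 2).  (vii) ROUTE = the print's ((2.6) +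
(2.10)/(2.11) summed over the scales), through kernel-proved tree files used BY NAME; theorems only, no definitions, no Literature
fact minted; standard axioms.  Value = kernel certificate of a located by-reference step of B3 on the paper's own lattice `T_η` at
zero background, NOT summit progress.
Unit `lit-balaban-p03-g5` (Phase-2 proof seat p03, gen 5); HOME `run/shared/lean/pub/lit-balaban/` (row B3.Eq3.1, FILED.md, STATUS.md).
-/

namespace Literature.MathematicalPhysics.QuantumFieldTheory.Balaban1983to89.B3GkZeroTorusSeparated

open Finset Matrix B1RG242Torus B5Ineq137Torus
open B3Ineq210ZeroTorus B3Ineq211ZeroTorus B3Ineq210MixedTorus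
open B3Sect3KernelsZeroTorus (pieceT_symm)
open B3Sect2StatementsPart2
open B4Thm110ZeroBox (sc)
open B3GkZeroBoxSeparated (scaleSum_sep_le)

noncomputable section

variable {P : Params}

/-! ## §0 Scale bookkeeping and the generic summation over the pieces at separated arguments -/

/-- kernel: `L^jε·L^{k−j} = L^kε`. [folklore] -/
private theorem spacing_mul_pow_sub {j k : ℕ} (hjk : j ≤ k) : P.spacing j * (P.L : ℝ) ^ (k - j) = P.spacing k := by
  unfold Params.spacing
  rw [mul_right_comm, ← pow_add, Nat.add_sub_cancel' hjk]

/-- kernel: `|x−x′|_T/L^j = (|x−x′|_T/L^k)·L^{k−j}` for `j ≤ k`. [folklore] -/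
private theorem div_pow_eq_div_mul {j k : ℕ} (hjk : j ≤ k) (t : ℝ) :
    t / (P.L : ℝ) ^ j = t / (P.L : ℝ) ^ k * (P.L : ℝ) ^ (k - j) := by
  have hL : (P.L : ℝ) ≠ 0 := P.cast_L_pos.ne'
  obtain ⟨m, rfl⟩ := Nat.exists_eq_add_of_le hjk
  rw [Nat.add_sub_cancel_left, pow_add]
  field_simp

/-- kernel: `(L^jη)^{−1}·(ε|x−x′|_T) = |x−x′|_T/L^j`. [folklore] -/
private theorem scale_inv_mul_dist (j : ℕ) (t : ℝ) : (P.spacing j)⁻¹ * (P.eps * t) = t / (P.L : ℝ) ^ j := by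
  unfold Params.spacing
  rw [mul_inv, mul_assoc, ← mul_assoc (P.eps)⁻¹, inv_mul_cancel₀ P.eps_pos.ne', one_mul, div_eq_inv_mul]

/-- kernel: `(L^jη)^{2−d} = (L^jη)²·((L^jη)^d)^{−1}` (real exponent). [folklore] -/
private theorem rpow_two_sub (j : ℕ) :
    P.spacing j ^ ((2 : ℝ) - (P.d : ℝ)) = P.spacing j ^ 2 * (P.spacing j ^ P.d)⁻¹ := by
  rw [Real.rpow_sub (P.spacing_pos j), div_eq_mul_inv, Real.rpow_natCast _ P.d, Real.rpow_two]

/-- kernel: `(L^jη)^{1−d} = (L^jη)·((L^jη)^d)^{−1}`. [folklore] -/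
private theorem rpow_one_sub (j : ℕ) :
    P.spacing j ^ ((1 : ℝ) - (P.d : ℝ)) = P.spacing j * (P.spacing j ^ P.d)⁻¹ := by
  rw [Real.rpow_sub (P.spacing_pos j), div_eq_mul_inv, Real.rpow_natCast _ P.d, Real.rpow_one]

/-- kernel: `(L^jη)^{1−d−α} = (L^jη)·((L^jη)^d)^{−1}·((L^jη)^α)^{−1}`. [folklore] -/
private theorem rpow_one_sub_sub (j : ℕ) (α : ℝ) :
    P.spacing j ^ ((1 : ℝ) - (P.d : ℝ) - α) = P.spacing j * (P.spacing j ^ P.d)⁻¹ * (P.spacing j ^ α)⁻¹ := by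
  rw [Real.rpow_sub (P.spacing_pos j), rpow_one_sub, div_eq_mul_inv]

/-- kernel: below the top scale the weight `x^a(x^d)^{−1}` of a piece (`x = L^jε`) is at most `s^d` times the weight of the top scale
(`xs = L^kε`, `s = L^{k−j} ≥ 1`). [folklore] -/
private theorem weight_scale {x s : ℝ} (hx : 0 < x) (hs : 1 ≤ s) (a d : ℕ) :
    x ^ a * (x ^ d)⁻¹ ≤ s ^ d * ((x * s) ^ a * ((x * s) ^ d)⁻¹) := by
  have hs0 : 0 < s := by linarith
  have e : s ^ d * ((x * s) ^ a * ((x * s) ^ d)⁻¹) = s ^ a * (x ^ a * (x ^ d)⁻¹) := by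
    rw [mul_pow, mul_pow, mul_inv]
    field_simp
  rw [e]
  have h1 : 1 ≤ s ^ a := one_le_pow₀ hs
  have h0 : 0 ≤ x ^ a * (x ^ d)⁻¹ := by positivity
  nlinarith

/-- kernel: the same for the Hölder weight `x(x^d)^{−1}(x^α)^{−1}`, `α ≤ 1` (`s^α ≤ s`). [folklore] -/
private theorem weight_scale_holder {x s α : ℝ} (hx : 0 < x) (hs : 1 ≤ s) (hα1 : α ≤ 1) (d : ℕ) :
    x * (x ^ d)⁻¹ * (x ^ α)⁻¹ ≤ s ^ d * ((x * s) * ((x * s) ^ d)⁻¹ * ((x * s) ^ α)⁻¹) := by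
  have hs0 : 0 < s := by linarith
  have hxα : 0 < x ^ α := Real.rpow_pos_of_pos hx α
  have hsα : 0 < s ^ α := Real.rpow_pos_of_pos hs0 α
  have e : s ^ d * ((x * s) * ((x * s) ^ d)⁻¹ * ((x * s) ^ α)⁻¹) = (s * (s ^ α)⁻¹) * (x * (x ^ d)⁻¹ * (x ^ α)⁻¹) := by
    rw [mul_pow, Real.mul_rpow hx.le hs0.le, mul_inv, mul_inv]
    field_simp
  rw [e]
  have h1 : 1 ≤ s * (s ^ α)⁻¹ := by
    rw [← div_eq_mul_inv, le_div_iff₀ hsα, one_mul]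
    calc s ^ α ≤ s ^ (1 : ℝ) := Real.rpow_le_rpow_of_exponent_le hs hα1
      _ = s := Real.rpow_one s
  have h0 : 0 ≤ x * (x ^ d)⁻¹ * (x ^ α)⁻¹ := by positivity
  nlinarith

/-- kernel: `L = (L − 1) + 1` in `ℝ` for `L ≥ 1`. [folklore] -/
private theorem cast_pred_add_one {L : ℕ} (hL : 1 ≤ L) : (((L - 1 : ℕ) : ℝ) + 1) = (L : ℝ) := by
  rw [Nat.cast_sub hL]; push_cast; ring

/-- **The summation over the pieces of (2.6) at separated arguments.**  If the `j`-th piece is bounded by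
`W·(L^{k−j})^p·e^{−δ·D·L^{k−j}}` with `D ≥ ρ > 0` (a decay on the scale `L^j` in a fine distance `DL^k ≥ ρL^k`), then the sum of the
`k` pieces is `≤ W·[p!/(δρ/2)^p·(1 − e^{−(δρ/2)L})^{−1}]·e^{−(δL/2)·D}` — the printed decomposition *"G_k(Ω,B̃) = Σ_{j=0}^{k−1}
G^η_{(j)}(Ω,B̃) (2.6)"* summed with (2.10) at separation (`B3GkZeroBoxSeparated.scaleSum_sep_le` with `s_j = L^{k−j}`).
[cite: Balaban1983Higgs3, (2.6) p.424] -/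
theorem abs_sum_range_sep_le {L : ℕ} (hL : 1 < L) {δ ρ : ℝ} (hδ : 0 < δ) (hρ : 0 < ρ) (p k : ℕ) {D W : ℝ} (hD : ρ ≤ D)
    (hW : 0 ≤ W) (g : ℕ → ℝ)
    (hg : ∀ j ∈ range k, |g j| ≤ W * (((L : ℝ) ^ (k - j)) ^ p * Real.exp (-(δ * D * (L : ℝ) ^ (k - j))))) :
    |∑ j ∈ range k, g j| ≤ W * ((p.factorial : ℝ) / (δ * ρ / 2) ^ p * (1 - Real.exp (-(δ * ρ / 2 * (L : ℝ))))⁻¹)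
        * Real.exp (-(δ * (L : ℝ) / 2 * D)) := by
  have hℓ : 1 ≤ L - 1 := by omega
  have hcast := cast_pred_add_one (le_of_lt hL)
  have hsc : ∀ j, sc (L - 1) k j = (L : ℝ) ^ (k - j) := fun j => by unfold sc; rw [hcast]
  have hS := scaleSum_sep_le hℓ hδ hρ p k hD
  rw [hcast] at hS
  simp only [hsc] at hS
  calc |∑ j ∈ range k, g j| ≤ ∑ j ∈ range k, |g j| := abs_sum_le_sum_abs _ _
    _ ≤ ∑ j ∈ range k, W * (((L : ℝ) ^ (k - j)) ^ p * Real.exp (-(δ * D * (L : ℝ) ^ (k - j)))) := sum_le_sum hg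
    _ = W * ∑ j ∈ range k, ((L : ℝ) ^ (k - j)) ^ p * Real.exp (-(δ * D * (L : ℝ) ^ (k - j))) := by rw [mul_sum]
    _ ≤ _ := by rw [mul_assoc]; exact mul_le_mul_of_nonneg_left hS hW

/-- kernel: the constant of `abs_sum_range_sep_le` is positive. [folklore] -/
private theorem sepConst_pos {L : ℕ} (hL : 1 < L) {δ ρ : ℝ} (hδ : 0 < δ) (hρ : 0 < ρ) (p : ℕ) :
    0 < (p.factorial : ℝ) / (δ * ρ / 2) ^ p * (1 - Real.exp (-(δ * ρ / 2 * (L : ℝ))))⁻¹ := by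
  have hL0 : (0 : ℝ) < L := by exact_mod_cast (zero_lt_one.trans hL)
  have h1 : Real.exp (-(δ * ρ / 2 * (L : ℝ))) < 1 := Real.exp_lt_one_iff.2 (by nlinarith [mul_pos hδ hρ])
  have h2 : (0 : ℝ) < p.factorial := by exact_mod_cast Nat.factorial_pos p
  have h3 : 0 < (δ * ρ / 2) ^ p := pow_pos (by positivity) p
  exact mul_pos (div_pos h2 h3) (inv_pos.2 (by linarith))

/-- kernel: a piece bound `W·w_j·e^{−δ₁|x−x′|_T/L^j}` with `w_j ≤ (L^{k−j})^d·w_k` is of the shape of `abs_sum_range_sep_le` with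
`D = |x−x′|_T/L^k`. [folklore] -/
private theorem piece_shape {j k : ℕ} (hjk : j ≤ k) {W wj wk t δ₁ B : ℝ} (hW : 0 ≤ W)
    (hw : wj ≤ ((P.L : ℝ) ^ (k - j)) ^ P.d * wk) (hB : B ≤ W * wj * Real.exp (-(δ₁ * (t / (P.L : ℝ) ^ j)))) :
    B ≤ W * wk * ((((P.L : ℝ) ^ (k - j)) ^ P.d) * Real.exp (-(δ₁ * (t / (P.L : ℝ) ^ k) * (P.L : ℝ) ^ (k - j)))) := by
  have hE : 0 ≤ Real.exp (-(δ₁ * (t / (P.L : ℝ) ^ j))) := (Real.exp_pos _).le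
  rw [div_pow_eq_div_mul hjk, ← mul_assoc] at hB hE
  calc B ≤ W * wj * Real.exp (-(δ₁ * (t / (P.L : ℝ) ^ k) * (P.L : ℝ) ^ (k - j))) := hB
    _ ≤ W * ((((P.L : ℝ) ^ (k - j)) ^ P.d) * wk) * Real.exp (-(δ₁ * (t / (P.L : ℝ) ^ k) * (P.L : ℝ) ^ (k - j))) :=
        mul_le_mul_of_nonneg_right (mul_le_mul_of_nonneg_left hw hW) hE
    _ = _ := by ring

/-! ## §1 The full propagator `G^ε_k = Σ_{j<k}G_{(j)}`: symmetry and the entry formulas of its differences -/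

section Entries

variable {a msq : ℝ} {k : ℕ}

/-- **`G_k(T_η,0)` is a symmetric kernel**: `G^ε_k(x,x′) = G^ε_k(x′,x)` (each piece of (2.6) is symmetric, `pieceT_symm`).
[cite: Balaban1983Higgs3, (2.6) p.424] -/
theorem Gk_symm (ha : 0 < a) (hm : 0 ≤ msq) (hk : 1 ≤ k) (hkm : k ≤ P.m + P.K) (x x' : Site P 0) :
    (tower P a msq).G k x x' = (tower P a msq).G k x' x := by
  rw [← sum_pieceT (P := P) ha hm hk, Matrix.sum_apply, Matrix.sum_apply]
  exact sum_congr rfl fun j _ => pieceT_symm ha hm hkm j x x'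

/-- The entries of `G^ε_k` are the sums of the entries of the pieces. [cite: Balaban1983Higgs3, (2.6) p.424] -/
theorem Gk_apply (ha : 0 < a) (hm : 0 ≤ msq) (hk : 1 ≤ k) (x x' : Site P 0) :
    (tower P a msq).G k x x' = ∑ j ∈ range k, pieceT P a msq k j x x' := by
  rw [← sum_pieceT (P := P) ha hm hk, Matrix.sum_apply]

/-- The row difference quotient of `G^ε_k` is the sum of those of the pieces:
`ε^{−1}(G_k(x+e_μ,x′) − G_k(x,x′)) = Σ_{j<k}(∂^ε_μG_{(j)})(x,x′)`. [cite: Balaban1983Higgs3, (2.6) p.424, (2.10) p.426] -/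
theorem GkDiff_apply (ha : 0 < a) (hm : 0 ≤ msq) (hk : 1 ≤ k) (μ : Fin P.d) (x x' : Site P 0) :
    P.eps⁻¹ * ((tower P a msq).G k (Site.shift x μ) x' - (tower P a msq).G k x x')
      = ∑ j ∈ range k, (deriv P 0 P.eps μ * pieceT P a msq k j) x x' := by
  rw [Gk_apply ha hm hk, Gk_apply ha hm hk, ← sum_sub_distrib, mul_sum]
  exact sum_congr rfl fun j _ => (B5Leaf235Torus.deriv_mul_apply P.eps μ _ x x').symm

/-- The mixed second difference quotient of `G^ε_k` is the sum of those of the pieces: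
`ε^{−2}[G_k(x+e_μ,x′+e_ν) − G_k(x+e_μ,x′) − G_k(x,x′+e_ν) + G_k(x,x′)] = Σ_{j<k}(∂^ε_μG_{(j)}∂^{ε*}_ν)(x,x′)`.
[cite: Balaban1983Higgs3, (2.6) p.424, (2.10) p.426] -/
theorem GkMixed_apply (ha : 0 < a) (hm : 0 ≤ msq) (hk : 1 ≤ k) (μ ν : Fin P.d) (x x' : Site P 0) :
    P.eps⁻¹ * P.eps⁻¹ * ((tower P a msq).G k (Site.shift x μ) (Site.shift x' ν) - (tower P a msq).G k (Site.shift x μ) x'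
        - (tower P a msq).G k x (Site.shift x' ν) + (tower P a msq).G k x x')
      = ∑ j ∈ range k, mixedT P P.eps μ ν (pieceT P a msq k j) x x' := by
  have h : ∀ j ∈ range k, mixedT P P.eps μ ν (pieceT P a msq k j) x x' = P.eps⁻¹ * P.eps⁻¹ *
      (pieceT P a msq k j (Site.shift x μ) (Site.shift x' ν) - pieceT P a msq k j (Site.shift x μ) x'
        - pieceT P a msq k j x (Site.shift x' ν) + pieceT P a msq k j x x') := fun j _ => mixedT_apply _ _ _ _ _ _
  rw [sum_congr rfl h, ← mul_sum, Gk_apply ha hm hk, Gk_apply ha hm hk, Gk_apply ha hm hk, Gk_apply ha hm hk,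
    ← sum_sub_distrib, ← sum_sub_distrib, ← sum_add_distrib]

end Entries

/-! ## §2 The six kernel clauses at separated arguments `|x−x′|_T ≥ ρL^k` -/

section Clauses

/-- **VALUE CLAUSE at separation.**  For `d ≥ 1`, odd `L > 1`, `a > 0`, `m² ≥ 0`, `ρ > 0` there are `δ₀ > 0`, `C > 0` such that for
every volume `P = (d, L, m, K)`, every scale `1 ≤ k ≤ K` and all fine sites with `|x−x′|_T ≥ ρL^k`:
`ε^{−d}|G^ε_k(x,x′)| ≤ C·(L^kε)²((L^kε)^d)^{−1}·e^{−δ₀|x−x′|_T/L^k}` — (2.6) + the value clause of (2.10) summed over the scales (no power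
of the distance survives at separation). [cite: Balaban1983Higgs3, (3.1) p.432] -/
theorem abs_Gk_sep_le (d L : ℕ) (hd : 1 ≤ d) (hL : Odd L ∧ 1 < L) {a : ℝ} (ha : 0 < a) {msq : ℝ} (hmsq : 0 ≤ msq)
    {ρ : ℝ} (hρ : 0 < ρ) :
    ∃ δ₀ C : ℝ, 0 < δ₀ ∧ 0 < C ∧ ∀ (P : Params), P.d = d → P.L = L → ∀ k : ℕ, 1 ≤ k → k ≤ P.K →
      ∀ x x' : Site P 0, ρ * (P.L : ℝ) ^ k ≤ T P 0 x x' →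
        (P.eps ^ P.d)⁻¹ * |(tower P a msq).G k x x'|
          ≤ C * (P.spacing k ^ 2 * (P.spacing k ^ P.d)⁻¹) * Real.exp (-(δ₀ * (T P 0 x x' / (P.L : ℝ) ^ k))) := by
  obtain ⟨δ₁, C, hδ₁, hC, h210⟩ := ineq210_zeroTorus d L hd hL ha hmsq
  have hK := sepConst_pos hL.2 hδ₁ hρ d
  have hL0 : (0 : ℝ) < L := by exact_mod_cast (zero_lt_one.trans hL.2)
  refine ⟨δ₁ * (L : ℝ) / 2, C * ((d.factorial : ℝ) / (δ₁ * ρ / 2) ^ d * (1 - Real.exp (-(δ₁ * ρ / 2 * (L : ℝ))))⁻¹),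
    by positivity, mul_pos hC hK, ?_⟩
  intro P hPd hPL k hk1 hkK x x' hsep
  have h := h210 P hPd hPL k hk1 hkK
  subst hPd hPL
  have hLk : 0 < (P.L : ℝ) ^ k := pow_pos P.cast_L_pos k
  have hD : ρ ≤ T P 0 x x' / (P.L : ℝ) ^ k := by rw [le_div_iff₀ hLk]; exact hsep
  have hεd : 0 < (P.eps ^ P.d)⁻¹ := by have := P.eps_pos; positivity
  set wk : ℝ := P.spacing k ^ 2 * (P.spacing k ^ P.d)⁻¹ with hwk
  have hwk0 : 0 ≤ wk := by have := P.spacing_pos k; positivity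
  -- the pieces in the shape of the generic summation
  have hg : ∀ j ∈ range k, |(P.eps ^ P.d)⁻¹ * pieceT P a msq k j x x'|
      ≤ C * wk * ((((P.L : ℝ) ^ (k - j)) ^ P.d) * Real.exp (-(δ₁ * (T P 0 x x' / (P.L : ℝ) ^ k) * (P.L : ℝ) ^ (k - j)))) := by
    intro j hj
    have hjk : j ≤ k := (mem_range.1 hj).le
    have h1 := (h j x x').1
    change (P.eps ^ P.d)⁻¹ * |pieceT P a msq k j x x'| ≤ C * P.spacing j ^ ((2 : ℝ) - (P.d : ℝ)) *
      Real.exp (-(δ₁ * (P.spacing j)⁻¹ * (P.eps * T P 0 x x'))) at h1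
    rw [rpow_two_sub, mul_assoc δ₁, scale_inv_mul_dist] at h1
    rw [abs_mul, abs_of_pos hεd]
    refine piece_shape hjk hC.le ?_ h1
    have hw := weight_scale (P.spacing_pos j) (one_le_pow₀ (one_lt_cast_L P).le : (1:ℝ) ≤ (P.L : ℝ) ^ (k - j)) 2 P.d
    rwa [spacing_mul_pow_sub hjk] at hw
  have hS := abs_sum_range_sep_le P.hL.2 hδ₁ hρ P.d k hD (mul_nonneg hC.le hwk0) _ hg
  rw [← mul_sum, abs_mul, abs_of_pos hεd, ← Gk_apply ha hmsq hk1] at hS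
  calc (P.eps ^ P.d)⁻¹ * |(tower P a msq).G k x x'|
      ≤ C * wk * ((P.d.factorial : ℝ) / (δ₁ * ρ / 2) ^ P.d * (1 - Real.exp (-(δ₁ * ρ / 2 * (P.L : ℝ))))⁻¹)
        * Real.exp (-(δ₁ * (P.L : ℝ) / 2 * (T P 0 x x' / (P.L : ℝ) ^ k))) := hS
    _ = _ := by ring

/-- **ROW DERIVATIVE CLAUSE at separation**: `ε^{−d}·ε^{−1}|G^ε_k(x+e_μ,x′) − G^ε_k(x,x′)| ≤ C·(L^kε)((L^kε)^d)^{−1}·e^{−δ₀|x−x′|_T/L^k}`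
for `|x−x′|_T ≥ ρL^k` — (2.6) + the derivative clause of (2.10) («for each differentiation an additional factor (L^jη)^{−1}») summed
over the scales. [cite: Balaban1983Higgs3, (3.1) p.432] -/
theorem abs_GkDiff_sep_le (d L : ℕ) (hd : 1 ≤ d) (hL : Odd L ∧ 1 < L) {a : ℝ} (ha : 0 < a) {msq : ℝ} (hmsq : 0 ≤ msq)
    {ρ : ℝ} (hρ : 0 < ρ) :
    ∃ δ₀ C : ℝ, 0 < δ₀ ∧ 0 < C ∧ ∀ (P : Params), P.d = d → P.L = L → ∀ k : ℕ, 1 ≤ k → k ≤ P.K →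
      ∀ (μ : Fin P.d) (x x' : Site P 0), ρ * (P.L : ℝ) ^ k ≤ T P 0 x x' →
        (P.eps ^ P.d)⁻¹ * (P.eps⁻¹ * |(tower P a msq).G k (Site.shift x μ) x' - (tower P a msq).G k x x'|)
          ≤ C * (P.spacing k * (P.spacing k ^ P.d)⁻¹) * Real.exp (-(δ₀ * (T P 0 x x' / (P.L : ℝ) ^ k))) := by
  obtain ⟨δ₁, C, hδ₁, hC, h210⟩ := ineq210_zeroTorus d L hd hL ha hmsq
  have hK := sepConst_pos hL.2 hδ₁ hρ d
  have hL0 : (0 : ℝ) < L := by exact_mod_cast (zero_lt_one.trans hL.2)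
  refine ⟨δ₁ * (L : ℝ) / 2, C * ((d.factorial : ℝ) / (δ₁ * ρ / 2) ^ d * (1 - Real.exp (-(δ₁ * ρ / 2 * (L : ℝ))))⁻¹),
    by positivity, mul_pos hC hK, ?_⟩
  intro P hPd hPL k hk1 hkK μ x x' hsep
  have h := h210 P hPd hPL k hk1 hkK
  subst hPd hPL
  have hLk : 0 < (P.L : ℝ) ^ k := pow_pos P.cast_L_pos k
  have hD : ρ ≤ T P 0 x x' / (P.L : ℝ) ^ k := by rw [le_div_iff₀ hLk]; exact hsep
  have hε := P.eps_pos
  have hεd : 0 < (P.eps ^ P.d)⁻¹ := by positivity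
  set wk : ℝ := P.spacing k * (P.spacing k ^ P.d)⁻¹ with hwk
  have hwk0 : 0 ≤ wk := by have := P.spacing_pos k; positivity
  have hg : ∀ j ∈ range k, |(P.eps ^ P.d)⁻¹ * (deriv P 0 P.eps μ * pieceT P a msq k j) x x'|
      ≤ C * wk * ((((P.L : ℝ) ^ (k - j)) ^ P.d) * Real.exp (-(δ₁ * (T P 0 x x' / (P.L : ℝ) ^ k) * (P.L : ℝ) ^ (k - j)))) := by
    intro j hj
    have hjk : j ≤ k := (mem_range.1 hj).le
    have h1 := (h j x x').2 μ
    change (P.eps ^ P.d)⁻¹ * |(deriv P 0 P.eps μ * pieceT P a msq k j) x x'| ≤ C * P.spacing j ^ ((1 : ℝ) - (P.d : ℝ)) *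
      Real.exp (-(δ₁ * (P.spacing j)⁻¹ * (P.eps * T P 0 x x'))) at h1
    rw [rpow_one_sub, mul_assoc δ₁, scale_inv_mul_dist] at h1
    rw [abs_mul, abs_of_pos hεd]
    refine piece_shape hjk hC.le ?_ h1
    have hw := weight_scale (P.spacing_pos j) (one_le_pow₀ (one_lt_cast_L P).le : (1:ℝ) ≤ (P.L : ℝ) ^ (k - j)) 1 P.d
    rwa [pow_one, pow_one, spacing_mul_pow_sub hjk] at hw
  have hS := abs_sum_range_sep_le P.hL.2 hδ₁ hρ P.d k hD (mul_nonneg hC.le hwk0) _ hg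
  rw [← mul_sum, abs_mul, abs_of_pos hεd, ← GkDiff_apply ha hmsq hk1, abs_mul, abs_of_pos (inv_pos.2 hε)] at hS
  calc (P.eps ^ P.d)⁻¹ * (P.eps⁻¹ * |(tower P a msq).G k (Site.shift x μ) x' - (tower P a msq).G k x x'|)
      ≤ C * wk * ((P.d.factorial : ℝ) / (δ₁ * ρ / 2) ^ P.d * (1 - Real.exp (-(δ₁ * ρ / 2 * (P.L : ℝ))))⁻¹)
        * Real.exp (-(δ₁ * (P.L : ℝ) / 2 * (T P 0 x x' / (P.L : ℝ) ^ k))) := hS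
    _ = _ := by ring

/-- **COLUMN DERIVATIVE CLAUSE at separation**: `ε^{−d}·ε^{−1}|G^ε_k(x,x′+e_ν) − G^ε_k(x,x′)| ≤ C·(L^kε)((L^kε)^d)^{−1}·e^{−δ₀|x−x′|_T/L^k}`
for `|x−x′|_T ≥ ρL^k` — the row clause at the swapped arguments, by the symmetry of `G_k` (`Gk_symm`).
[cite: Balaban1983Higgs3, (3.1) p.432] -/
theorem abs_GkDiff'_sep_le (d L : ℕ) (hd : 1 ≤ d) (hL : Odd L ∧ 1 < L) {a : ℝ} (ha : 0 < a) {msq : ℝ} (hmsq : 0 ≤ msq)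
    {ρ : ℝ} (hρ : 0 < ρ) :
    ∃ δ₀ C : ℝ, 0 < δ₀ ∧ 0 < C ∧ ∀ (P : Params), P.d = d → P.L = L → ∀ k : ℕ, 1 ≤ k → k ≤ P.K →
      ∀ (ν : Fin P.d) (x x' : Site P 0), ρ * (P.L : ℝ) ^ k ≤ T P 0 x x' →
        (P.eps ^ P.d)⁻¹ * (P.eps⁻¹ * |(tower P a msq).G k x (Site.shift x' ν) - (tower P a msq).G k x x'|)
          ≤ C * (P.spacing k * (P.spacing k ^ P.d)⁻¹) * Real.exp (-(δ₀ * (T P 0 x x' / (P.L : ℝ) ^ k))) := by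
  obtain ⟨δ₀, C, hδ₀, hC, h⟩ := abs_GkDiff_sep_le d L hd hL ha hmsq hρ
  refine ⟨δ₀, C, hδ₀, hC, fun P hPd hPL k hk1 hkK ν x x' hsep => ?_⟩
  have hkm : k ≤ P.m + P.K := hkK.trans (Nat.le_add_left _ _)
  rw [Gk_symm ha hmsq hk1 hkm x (Site.shift x' ν), Gk_symm ha hmsq hk1 hkm x x', T_symm P 0 x x']
  rw [T_symm P 0 x x'] at hsep
  exact h P hPd hPL k hk1 hkK ν x' x hsep

/-- kernel: distinct fine sites are at positive torus distance. [folklore] -/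
private theorem T_pos_of_ne {x x' : Site P 0} (hne : x ≠ x') : 0 < T P 0 x x' :=
  lt_of_le_of_ne (T_nonneg P 0 _ _) fun h0 => hne (eq_of_T_eq_zero P h0.symm)

/-- **HÖLDER CLAUSE at separation (row derivative, row variable), per `0 ≤ α < 1`**: for `x₁ ≠ x₂` and
`dist({x₁,x₂},x) = min(|x₁−x|_T,|x₂−x|_T) ≥ ρL^k`,
`ε^{−d}·ε^{−1}|[G^ε_k(x₂+e_μ,x) − G^ε_k(x₂,x)] − [G^ε_k(x₁+e_μ,x) − G^ε_k(x₁,x)]|/(ε|x₁−x₂|_T)^α ≤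
C·(L^kε)((L^kε)^d)^{−1}((L^kε)^α)^{−1}·e^{−δ₀dist({x₁,x₂},x)/L^k}` — (2.6) + (2.11) summed over the scales (`U ≡ 1`).
[cite: Balaban1983Higgs3, (3.1) p.432] -/
theorem abs_GkDD_sep_le (d L : ℕ) (hd : 1 ≤ d) (hL : Odd L ∧ 1 < L) {a : ℝ} (ha : 0 < a) {msq : ℝ} (hmsq : 0 ≤ msq)
    {α : ℝ} (hα0 : 0 ≤ α) (hα1 : α < 1) {ρ : ℝ} (hρ : 0 < ρ) :
    ∃ δ₀ C : ℝ, 0 < δ₀ ∧ 0 < C ∧ ∀ (P : Params), P.d = d → P.L = L → ∀ k : ℕ, 1 ≤ k → k ≤ P.K →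
      ∀ (μ : Fin P.d) (x₁ x₂ x : Site P 0), x₁ ≠ x₂ → ρ * (P.L : ℝ) ^ k ≤ min (T P 0 x₁ x) (T P 0 x₂ x) →
        (P.eps ^ P.d)⁻¹ * (P.eps⁻¹ * |((tower P a msq).G k (Site.shift x₂ μ) x - (tower P a msq).G k x₂ x)
            - ((tower P a msq).G k (Site.shift x₁ μ) x - (tower P a msq).G k x₁ x)|) / (P.eps * T P 0 x₁ x₂) ^ α
          ≤ C * (P.spacing k * (P.spacing k ^ P.d)⁻¹ * (P.spacing k ^ α)⁻¹)
              * Real.exp (-(δ₀ * (min (T P 0 x₁ x) (T P 0 x₂ x) / (P.L : ℝ) ^ k))) := by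
  obtain ⟨δ₁, C, hδ₁, hC, h211⟩ := ineq211At_zeroTorusH d L hd hL ha hmsq hα0 hα1
  have hK := sepConst_pos hL.2 hδ₁ hρ d
  have hL0 : (0 : ℝ) < L := by exact_mod_cast (zero_lt_one.trans hL.2)
  refine ⟨δ₁ * (L : ℝ) / 2, C * ((d.factorial : ℝ) / (δ₁ * ρ / 2) ^ d * (1 - Real.exp (-(δ₁ * ρ / 2 * (L : ℝ))))⁻¹),
    by positivity, mul_pos hC hK, ?_⟩
  intro P hPd hPL k hk1 hkK μ x₁ x₂ x hne hsep
  have h := h211 P hPd hPL k hk1 hkK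
  subst hPd hPL
  have hLk : 0 < (P.L : ℝ) ^ k := pow_pos P.cast_L_pos k
  set m : ℝ := min (T P 0 x₁ x) (T P 0 x₂ x) with hm
  have hD : ρ ≤ m / (P.L : ℝ) ^ k := by rw [le_div_iff₀ hLk]; exact hsep
  have hε := P.eps_pos
  have hεd : 0 < (P.eps ^ P.d)⁻¹ := by positivity
  have hw : 0 < (P.eps * T P 0 x₁ x₂) ^ α := Real.rpow_pos_of_pos (mul_pos hε (T_pos_of_ne hne)) α
  set wk : ℝ := P.spacing k * (P.spacing k ^ P.d)⁻¹ * (P.spacing k ^ α)⁻¹ with hwk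
  have hwk0 : 0 ≤ wk := by
    have := P.spacing_pos k; have := Real.rpow_pos_of_pos this α; positivity
  have hg : ∀ j ∈ range k, |(P.eps ^ P.d)⁻¹ * ((deriv P 0 P.eps μ * pieceT P a msq k j) x₂ x
        - (deriv P 0 P.eps μ * pieceT P a msq k j) x₁ x) / (P.eps * T P 0 x₁ x₂) ^ α|
      ≤ C * wk * ((((P.L : ℝ) ^ (k - j)) ^ P.d) * Real.exp (-(δ₁ * (m / (P.L : ℝ) ^ k) * (P.L : ℝ) ^ (k - j)))) := by
    intro j hj
    have hjk : j ≤ k := (mem_range.1 hj).le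
    have h1 := h j μ x₁ x₂ x hne
    change (P.eps ^ P.d)⁻¹ * |(deriv P 0 P.eps μ * pieceT P a msq k j) x₂ x - (deriv P 0 P.eps μ * pieceT P a msq k j) x₁ x|
        / (P.eps * T P 0 x₁ x₂) ^ α ≤ C * P.spacing j ^ ((1 : ℝ) - (P.d : ℝ) - α) *
      Real.exp (-(δ₁ * (P.spacing j)⁻¹ * (P.eps * min (T P 0 x₁ x) (T P 0 x₂ x)))) at h1
    rw [rpow_one_sub_sub, mul_assoc δ₁, scale_inv_mul_dist] at h1
    rw [abs_div, abs_mul, abs_of_pos hεd, abs_of_pos hw]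
    refine piece_shape hjk hC.le ?_ h1
    have hw' := weight_scale_holder (P.spacing_pos j) (one_le_pow₀ (one_lt_cast_L P).le : (1:ℝ) ≤ (P.L : ℝ) ^ (k - j))
      hα1.le P.d
    rwa [spacing_mul_pow_sub hjk] at hw'
  have hS := abs_sum_range_sep_le P.hL.2 hδ₁ hρ P.d k hD (mul_nonneg hC.le hwk0) _ hg
  rw [← sum_div, ← mul_sum, sum_sub_distrib, ← GkDiff_apply ha hmsq hk1, ← GkDiff_apply ha hmsq hk1, ← mul_sub, abs_div,
    abs_mul, abs_of_pos hεd, abs_of_pos hw, abs_mul, abs_of_pos (inv_pos.2 hε)] at hS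
  calc (P.eps ^ P.d)⁻¹ * (P.eps⁻¹ * |((tower P a msq).G k (Site.shift x₂ μ) x - (tower P a msq).G k x₂ x)
            - ((tower P a msq).G k (Site.shift x₁ μ) x - (tower P a msq).G k x₁ x)|) / (P.eps * T P 0 x₁ x₂) ^ α
      ≤ C * wk * ((P.d.factorial : ℝ) / (δ₁ * ρ / 2) ^ P.d * (1 - Real.exp (-(δ₁ * ρ / 2 * (P.L : ℝ))))⁻¹)
        * Real.exp (-(δ₁ * (P.L : ℝ) / 2 * (m / (P.L : ℝ) ^ k))) := hS
    _ = _ := by ring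

/-- **HÖLDER CLAUSE at separation (column derivative, column variable), per `0 ≤ α < 1`**: for `x₁′ ≠ x₂′` and
`min(|x−x₁′|_T,|x−x₂′|_T) ≥ ρL^k`,
`ε^{−d}·ε^{−1}|[G^ε_k(x,x₂′+e_ν) − G^ε_k(x,x₂′)] − [G^ε_k(x,x₁′+e_ν) − G^ε_k(x,x₁′)]|/(ε|x₁′−x₂′|_T)^α ≤
C·(L^kε)((L^kε)^d)^{−1}((L^kε)^α)^{−1}·e^{−δ₀min(|x−x₁′|_T,|x−x₂′|_T)/L^k}` — the row clause at the swapped arguments (`Gk_symm`).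
[cite: Balaban1983Higgs3, (3.1) p.432] -/
theorem abs_GkDD'_sep_le (d L : ℕ) (hd : 1 ≤ d) (hL : Odd L ∧ 1 < L) {a : ℝ} (ha : 0 < a) {msq : ℝ} (hmsq : 0 ≤ msq)
    {α : ℝ} (hα0 : 0 ≤ α) (hα1 : α < 1) {ρ : ℝ} (hρ : 0 < ρ) :
    ∃ δ₀ C : ℝ, 0 < δ₀ ∧ 0 < C ∧ ∀ (P : Params), P.d = d → P.L = L → ∀ k : ℕ, 1 ≤ k → k ≤ P.K →
      ∀ (ν : Fin P.d) (x x₁' x₂' : Site P 0), x₁' ≠ x₂' → ρ * (P.L : ℝ) ^ k ≤ min (T P 0 x x₁') (T P 0 x x₂') →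
        (P.eps ^ P.d)⁻¹ * (P.eps⁻¹ * |((tower P a msq).G k x (Site.shift x₂' ν) - (tower P a msq).G k x x₂')
            - ((tower P a msq).G k x (Site.shift x₁' ν) - (tower P a msq).G k x x₁')|) / (P.eps * T P 0 x₁' x₂') ^ α
          ≤ C * (P.spacing k * (P.spacing k ^ P.d)⁻¹ * (P.spacing k ^ α)⁻¹)
              * Real.exp (-(δ₀ * (min (T P 0 x x₁') (T P 0 x x₂') / (P.L : ℝ) ^ k))) := by
  obtain ⟨δ₀, C, hδ₀, hC, h⟩ := abs_GkDD_sep_le d L hd hL ha hmsq hα0 hα1 hρ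
  refine ⟨δ₀, C, hδ₀, hC, fun P hPd hPL k hk1 hkK ν x x₁' x₂' hne hsep => ?_⟩
  have hkm : k ≤ P.m + P.K := hkK.trans (Nat.le_add_left _ _)
  rw [Gk_symm ha hmsq hk1 hkm x (Site.shift x₂' ν), Gk_symm ha hmsq hk1 hkm x x₂', Gk_symm ha hmsq hk1 hkm x (Site.shift x₁' ν),
    Gk_symm ha hmsq hk1 hkm x x₁', T_symm P 0 x x₁', T_symm P 0 x x₂']
  rw [T_symm P 0 x x₁', T_symm P 0 x x₂'] at hsep
  exact h P hPd hPL k hk1 hkK ν x₁' x₂' x hne hsep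

/-- **MIXED CLAUSE at separation (one derivative in each variable)**:
`ε^{−d}·ε^{−2}|G^ε_k(x+e_μ,x′+e_ν) − G^ε_k(x+e_μ,x′) − G^ε_k(x,x′+e_ν) + G^ε_k(x,x′)| ≤ C·((L^kε)^d)^{−1}·e^{−δ₀|x−x′|_T/L^k}` for
`|x−x′|_T ≥ ρL^k` — (2.6) + p20's twice-differentiated clause of (2.10) (`ineq210_mixed_zeroTorus`) summed over the scales.
[cite: Balaban1983Higgs3, (3.1) p.432] -/
theorem abs_GkMixed_sep_le (d L : ℕ) (hd : 1 ≤ d) (hL : Odd L ∧ 1 < L) {a : ℝ} (ha : 0 < a) {msq : ℝ} (hmsq : 0 ≤ msq)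
    {ρ : ℝ} (hρ : 0 < ρ) :
    ∃ δ₀ C : ℝ, 0 < δ₀ ∧ 0 < C ∧ ∀ (P : Params), P.d = d → P.L = L → ∀ k : ℕ, 1 ≤ k → k ≤ P.K →
      ∀ (μ ν : Fin P.d) (x x' : Site P 0), ρ * (P.L : ℝ) ^ k ≤ T P 0 x x' →
        (P.eps ^ P.d)⁻¹ * (P.eps⁻¹ * P.eps⁻¹ * |(tower P a msq).G k (Site.shift x μ) (Site.shift x' ν)
            - (tower P a msq).G k (Site.shift x μ) x' - (tower P a msq).G k x (Site.shift x' ν) + (tower P a msq).G k x x'|)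
          ≤ C * (P.spacing k ^ P.d)⁻¹ * Real.exp (-(δ₀ * (T P 0 x x' / (P.L : ℝ) ^ k))) := by
  obtain ⟨δ₁, C, hδ₁, hC, hM⟩ := ineq210_mixed_zeroTorus d L hd hL ha hmsq
  have hK := sepConst_pos hL.2 hδ₁ hρ d
  have hL0 : (0 : ℝ) < L := by exact_mod_cast (zero_lt_one.trans hL.2)
  refine ⟨δ₁ * (L : ℝ) / 2, C * ((d.factorial : ℝ) / (δ₁ * ρ / 2) ^ d * (1 - Real.exp (-(δ₁ * ρ / 2 * (L : ℝ))))⁻¹),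
    by positivity, mul_pos hC hK, ?_⟩
  intro P hPd hPL k hk1 hkK μ ν x x' hsep
  have h := hM P hPd hPL k hk1 hkK
  subst hPd hPL
  have hLk : 0 < (P.L : ℝ) ^ k := pow_pos P.cast_L_pos k
  have hD : ρ ≤ T P 0 x x' / (P.L : ℝ) ^ k := by rw [le_div_iff₀ hLk]; exact hsep
  have hε := P.eps_pos
  have hεd : 0 < (P.eps ^ P.d)⁻¹ := by positivity
  set wk : ℝ := (P.spacing k ^ P.d)⁻¹ with hwk
  have hwk0 : 0 ≤ wk := by have := P.spacing_pos k; positivity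
  have hg : ∀ j ∈ range k, |(P.eps ^ P.d)⁻¹ * mixedT P P.eps μ ν (pieceT P a msq k j) x x'|
      ≤ C * wk * ((((P.L : ℝ) ^ (k - j)) ^ P.d) * Real.exp (-(δ₁ * (T P 0 x x' / (P.L : ℝ) ^ k) * (P.L : ℝ) ^ (k - j)))) := by
    intro j hj
    have hjk : j ≤ k := (mem_range.1 hj).le
    have h1 := h j μ ν x x'
    rw [mul_assoc δ₁, scale_inv_mul_dist] at h1
    rw [abs_mul, abs_of_pos hεd]
    refine piece_shape hjk hC.le ?_ h1
    have hw := weight_scale (P.spacing_pos j) (one_le_pow₀ (one_lt_cast_L P).le : (1:ℝ) ≤ (P.L : ℝ) ^ (k - j)) 0 P.d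
    rwa [pow_zero, pow_zero, one_mul, one_mul, spacing_mul_pow_sub hjk] at hw
  have hS := abs_sum_range_sep_le P.hL.2 hδ₁ hρ P.d k hD (mul_nonneg hC.le hwk0) _ hg
  rw [← mul_sum, abs_mul, abs_of_pos hεd, ← GkMixed_apply ha hmsq hk1, abs_mul,
    abs_of_pos (mul_pos (inv_pos.2 hε) (inv_pos.2 hε))] at hS
  calc (P.eps ^ P.d)⁻¹ * (P.eps⁻¹ * P.eps⁻¹ * |(tower P a msq).G k (Site.shift x μ) (Site.shift x' ν)
            - (tower P a msq).G k (Site.shift x μ) x' - (tower P a msq).G k x (Site.shift x' ν) + (tower P a msq).G k x x'|)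
      ≤ C * wk * ((P.d.factorial : ℝ) / (δ₁ * ρ / 2) ^ P.d * (1 - Real.exp (-(δ₁ * ρ / 2 * (P.L : ℝ))))⁻¹)
        * Real.exp (-(δ₁ * (P.L : ℝ) / 2 * (T P 0 x x' / (P.L : ℝ) ^ k))) := hS
    _ = _ := by ring

end Clauses

/-! ## §3 Non-vacuity: the binders are inhabited (`d = 3`, `L = 3`, `a = 1`, `m² = 0`, `ρ = 1`; the volume `m = K = 1`, scale `k = 1`,
two fine sites at torus distance `9 ≥ 1·3¹`) -/

/-- The constants of `abs_Gk_sep_le` exist and the value clause is a genuine inequality for an explicit volume and pair of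
separated sites. [cite: Balaban1983Higgs3, (3.1) p.432] -/
theorem abs_Gk_sep_le_witness :
    ∃ δ₀ C : ℝ, 0 < δ₀ ∧ 0 < C ∧
      let P : Params := ⟨3, 3, 1, 1, by norm_num, ⟨⟨1, by norm_num⟩, by norm_num⟩⟩
      ∀ x x' : Site P 0, 1 * (P.L : ℝ) ^ 1 ≤ T P 0 x x' →
        (P.eps ^ P.d)⁻¹ * |(tower P 1 0).G 1 x x'|
          ≤ C * (P.spacing 1 ^ 2 * (P.spacing 1 ^ P.d)⁻¹) * Real.exp (-(δ₀ * (T P 0 x x' / (P.L : ℝ) ^ 1))) := by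
  obtain ⟨δ₀, C, hδ₀, hC, h⟩ :=
    abs_Gk_sep_le 3 3 (by norm_num) ⟨⟨1, by norm_num⟩, by norm_num⟩ (a := 1) one_pos (msq := 0) le_rfl (ρ := 1) one_pos
  exact ⟨δ₀, C, hδ₀, hC, h _ rfl rfl 1 le_rfl le_rfl⟩


end

end Literature.MathematicalPhysics.QuantumFieldTheory.Balaban1983to89.B3GkZeroTorusSeparated
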